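import Literature.NumberTheory.EllipticCurves.PAdicOneVariableRelNormCoherentUnitsRayAction
import Literature.NumberTheory.NumberFields.RayClassFieldLocalTowerNorm
import Literature.NumberTheory.GaloisRepresentations.LubinTateUnitBallIntegralClosure
import Literature.NumberTheory.GaloisRepresentations.LubinTateColemanRelativeBaseNormTwo
import HarnessLib

/-!
# `p = 2`, CM assembly at the split prime `v`: GLOBAL norm-coherent units along `K(𝔪v^{m+1})` AS ELEMENTS OF the
# `𝔓`-adic norm-coherent units `𝒰_𝔓 = RelNormCoherentUnits hπ E` — the map `x ↦ (ι x_m)_m`, its multiplicativity and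
# its `Gal(K̄/K(𝔪))`-equivariance for the `κ_v`-action (de Shalit II.4.5 (12)–(13), III.1.2: `β(𝔞) = (e_n(𝔞))_n ∈ 𝒰`)

Topic `NumberTheory/EllipticCurves`; namespace `Literature.NumberTheory.EllipticCurves`.

De Shalit II.4.5: "the elliptic units `Θ(1; 𝔣𝔭^{n+1}, 𝔞)` … form a norm-coherent sequence … `β(𝔞) = (e_n(𝔞)) ∈ 𝒰`", where
`𝒰 = ∏_𝔓 lim← 𝒪(K(𝔣𝔭^{n+1})_𝔓)^×` and the `𝔓`-component of the global `K(𝔣𝔭^{n+1})` is `Φ·k_ξ^{n+1}` (II.1.10).  In the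
tree's currency (the ABSOLUTE Lubin–Tate model `E ⊔ ltField π n ⊇ ι(K(𝔪v^{n+1}))` of
`RayClassFieldLocalTowerContainment.lean`, `𝒰_𝔓 = RelNormCoherentUnits hπ E` with the `κ_v`-action `rayAction` of
`PAdicOneVariableRelNormCoherentUnitsRayAction.lean`) THIS file builds the map from GLOBAL data to `𝒰_𝔓`:

* §1 `norm_mk_absClosureEmbedding_le_one_of_isIntegral` / `…_eq_one_…` — an algebraic integer of `K̄` lands in the unit
  ball of every finite `M ⊆ K̄_v` containing it, a global unit on the unit sphere (`isIntegral_iff_norm_le_one`);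
* §2 `coe_towerNorm_rayClassField_eq_of_forall_succ` — norm-coherence along `K(𝔪v^{m+1})` for CONSECUTIVE levels gives it for
  all `n ≤ m` (transitivity `towerNorm_towerNorm`) — de Shalit II.2.5 is stated one prime step at a time;
* §3 ★ `RelNormCoherentUnits.ofGlobal` — **a norm-coherent sequence of global units `x_m ∈ K(𝔪v^{m+1})` IS an element of
  `𝒰_𝔓`**: components `ι(x_m)`, norm-coherence by THE NORM COMPATIBILITY
  `absClosureEmbedding_towerNorm_rayClassField_mul_pow_eq`; `coe_val_ofGlobal`, `ofGlobal_congr`;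
* §4 ★ `ofGlobal_mul_eq` — multiplicativity (`β(𝔞𝔟)`-type bookkeeping), `ofGlobal_one_eq`;
* §5 ★★ `coe_val_rayAction_smul_ofGlobal` / `rayAction_smul_ofGlobal_eq_ofGlobal` — **EQUIVARIANCE**: for `g ∈ Gal(K̄/K(𝔪))`,
  `g • ofGlobal x = ofGlobal (m ↦ g|_{K(𝔪v^{m+1})} x_m)` — the `κ_v`-action on `𝒰_𝔓` IS the Galois action on the global
  units (the inertia lift `w_g` acts on `K(𝔪v^{m+1})` as `g`, `absRestrictNormalHom_eq_of_rayAdicCharacter_eq`).  With §4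
  this transports de Shalit II.2.4 (ii) `σ_𝔠 e(𝔞)·e(𝔠)^{N𝔞} = σ_𝔞 e(𝔠)·e(𝔞)^{N𝔠}` to the `hrel` of
  `exists_twisting_μ_eq_forall_seriesFamily` (brick B5 of the measure side of de Shalit II.4).

One definition with body (`RelNormCoherentUnits.ofGlobal`); theorems otherwise; the `CommMonoid`/`rayAction` structures
of the sibling file are enabled section-locally exactly as there; no named facts, no global instances, no `sorry`.

## References
* [deShalit1987] E. de Shalit, *Iwasawa theory of elliptic curves with complex multiplication* (1987), II.1.10 (p. 39),
  II.2.4 (ii), II.2.5 (i) (p. 44–48), II.4.5 (12)–(13) (p. 58), III.1.2 (p. 101).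
* [SerreLocalFields1979] J.-P. Serre, *Local Fields* (1979), Ch. II §2 Prop. 3.
-/

noncomputable section

open MvPowerSeries

namespace Literature.NumberTheory.EllipticCurves

section OfGlobal

open NumberField IsDedekindDomain IsDedekindDomain.HeightOneSpectrum Field ValuativeRel IsLocalRing
open Literature.NumberTheory.GaloisRepresentations Literature.NumberTheory.GaloisRepresentations.IsNonarchimedeanLocalField
  Literature.NumberTheory.GaloisRepresentations.LubinTate Literature.NumberTheory.PAdicHodge
  Literature.NumberTheory.GaloisRepresentations.ArtinLocalGlobal Literature.NumberTheory.NumberFields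

variable {K : Type} [Field K] [NumberField K] {𝔪 : Ideal (𝓞 K)} {v : HeightOneSpectrum (𝓞 K)}

attribute [local instance] ltNormUniformSpace ltNormIsUniformAddGroup rk1 nF nE fintypeResidueField

/-! ### §1. Algebraic integers of `K̄` land in the local unit balls; global units on the unit sphere -/

/-- **An algebraic integer `y ∈ K̄` with `ι y ∈ M` lies in the unit ball of `M`** (`M ⊆ K̄_v` finite over `K_v`): `ι y` is
integral over `ℤ`, hence over `𝒪[K_v]`, and the integral closure of `𝒪[K_v]` in `M` is `{‖·‖ ≤ 1}`.
[cite: SerreLocalFields1979, Ch. II §2 Prop. 3] -/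
theorem norm_mk_absClosureEmbedding_le_one_of_isIntegral
    (M : IntermediateField (v.adicCompletion K) (AlgebraicClosure (v.adicCompletion K))) [FiniteDimensional (v.adicCompletion K) M]
    {y : AlgebraicClosure K} (hy : IsIntegral ℤ y) (hyM : absClosureEmbedding K (v.adicCompletion K) y ∈ M) :
    ‖(⟨absClosureEmbedding K (v.adicCompletion K) y, hyM⟩ : M)‖ ≤ 1 := by
  refine (isIntegral_iff_norm_le_one M _).mp ?_
  obtain ⟨p, hp, hpy⟩ := hy
  -- `p(y) = 0` read in `K̄_v` through `ι` (ring maps out of `ℤ` are unique)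
  have h0 : Polynomial.eval₂ (Int.castRingHom (AlgebraicClosure (v.adicCompletion K)))
      (absClosureEmbedding K (v.adicCompletion K) y) p = 0 := by
    have e := Polynomial.hom_eval₂ p (algebraMap ℤ (AlgebraicClosure K))
      (absClosureEmbedding K (v.adicCompletion K)).toRingHom y
    rw [hpy, map_zero, RingHom.eq_intCast'
      ((absClosureEmbedding K (v.adicCompletion K)).toRingHom.comp (algebraMap ℤ (AlgebraicClosure K)))] at e
    exact e.symm
  refine ⟨p.map (Int.castRingHom 𝒪[v.adicCompletion K]), hp.map _, ?_⟩
  apply (algebraMap M (AlgebraicClosure (v.adicCompletion K))).injective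
  rw [map_zero, Polynomial.hom_eval₂, Polynomial.eval₂_map, RingHom.eq_intCast'
    (((algebraMap M (AlgebraicClosure (v.adicCompletion K))).comp
      (algebraMap 𝒪[v.adicCompletion K] M)).comp (Int.castRingHom 𝒪[v.adicCompletion K])),
    IntermediateField.algebraMap_apply]
  exact h0

/-- **A global unit `y ∈ K̄` (an algebraic integer with algebraic-integer inverse, `y ≠ 0`) with `ι y ∈ M` lies on the unit
sphere of `M`**: `‖ι y‖ ≤ 1`, `‖ι y⁻¹‖ ≤ 1` and `‖ι y‖·‖ι y⁻¹‖ = 1`. [cite: SerreLocalFields1979, Ch. II §2 Prop. 3] -/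
theorem norm_mk_absClosureEmbedding_eq_one_of_isIntegral
    (M : IntermediateField (v.adicCompletion K) (AlgebraicClosure (v.adicCompletion K))) [FiniteDimensional (v.adicCompletion K) M]
    {y : AlgebraicClosure K} (hy0 : y ≠ 0) (hy : IsIntegral ℤ y) (hy' : IsIntegral ℤ y⁻¹)
    (hyM : absClosureEmbedding K (v.adicCompletion K) y ∈ M) :
    ‖(⟨absClosureEmbedding K (v.adicCompletion K) y, hyM⟩ : M)‖ = 1 := by
  have hyM' : absClosureEmbedding K (v.adicCompletion K) y⁻¹ ∈ M := by rw [map_inv₀]; exact M.inv_mem hyM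
  have h1 := norm_mk_absClosureEmbedding_le_one_of_isIntegral M hy hyM
  have h2 := norm_mk_absClosureEmbedding_le_one_of_isIntegral M hy' hyM'
  have hprod : (⟨absClosureEmbedding K (v.adicCompletion K) y, hyM⟩ : M) *
      ⟨absClosureEmbedding K (v.adicCompletion K) y⁻¹, hyM'⟩ = 1 :=
    Subtype.ext (by
      rw [MulMemClass.coe_mul, OneMemClass.coe_one, ← map_mul, mul_inv_cancel₀ hy0, map_one])
  have h3 : ‖(⟨absClosureEmbedding K (v.adicCompletion K) y, hyM⟩ : M)‖ *
      ‖(⟨absClosureEmbedding K (v.adicCompletion K) y⁻¹, hyM'⟩ : M)‖ = 1 := by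
    rw [← norm_mul, hprod, norm_one]
  have h0 : 0 ≤ ‖(⟨absClosureEmbedding K (v.adicCompletion K) y⁻¹, hyM'⟩ : M)‖ := norm_nonneg _
  nlinarith [norm_nonneg (⟨absClosureEmbedding K (v.adicCompletion K) y, hyM⟩ : M)]

/-! ### §2. Norm-coherence along `K(𝔪v^{m+1})` from consecutive levels -/

/-- Transitivity bookkeeping: if `N_{K(𝔪v^{m+2})/K(𝔪v^{m+1})} x_{m+1} = x_m` for all `m` then
`N_{K(𝔪v^{m+1})/K(𝔪v^{n+1})} x_m = x_n` for all `n ≤ m` (de Shalit II.2.5 (i) is the one-prime-step statement).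
[cite: deShalit1987, II.2.5 (i) (p. 47), II.4.5 (p. 58)] -/
theorem coe_towerNorm_rayClassField_eq_of_forall_succ (h𝔪 : 𝔪 ≠ ⊥) (v : HeightOneSpectrum (𝓞 K))
    (x : ∀ m : ℕ, rayClassField K (𝔪 * v.asIdeal ^ (m + 1)))
    (hsucc : ∀ m : ℕ,
      ((@Algebra.norm (rayClassField K (𝔪 * v.asIdeal ^ (m + 1))) (rayClassField K (𝔪 * v.asIdeal ^ (m + 1 + 1))) _ _
          (towerAlgebra (rayClassField_mul_pow_succ_mono h𝔪 v (Nat.le_succ m))) (x (m + 1)) :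
        rayClassField K (𝔪 * v.asIdeal ^ (m + 1))) : AlgebraicClosure K) = x m)
    {n m : ℕ} (hnm : n ≤ m) :
    ((@Algebra.norm (rayClassField K (𝔪 * v.asIdeal ^ (n + 1))) (rayClassField K (𝔪 * v.asIdeal ^ (m + 1))) _ _
        (towerAlgebra (rayClassField_mul_pow_succ_mono h𝔪 v hnm)) (x m) :
      rayClassField K (𝔪 * v.asIdeal ^ (n + 1))) : AlgebraicClosure K) = x n := by
  induction m, hnm using Nat.le_induction with
  | base =>
    have hinst : (towerAlgebra (F := K) (rayClassField_mul_pow_succ_mono h𝔪 v (le_refl n))) =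
        Algebra.id (rayClassField K (𝔪 * v.asIdeal ^ (n + 1))) :=
      Algebra.algebra_ext _ _ fun y ↦ Subtype.ext rfl
    rw [hinst, Algebra.norm_self, MonoidHom.id_apply]
  | succ m hnm ih =>
    rw [← towerNorm_towerNorm (F := K) (rayClassField_mul_pow_succ_mono h𝔪 v hnm)
      (rayClassField_mul_pow_succ_mono h𝔪 v (Nat.le_succ m)) (x (m + 1))]
    have e : @Algebra.norm (rayClassField K (𝔪 * v.asIdeal ^ (m + 1))) (rayClassField K (𝔪 * v.asIdeal ^ (m + 1 + 1))) _ _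
        (towerAlgebra (rayClassField_mul_pow_succ_mono h𝔪 v (Nat.le_succ m))) (x (m + 1)) = x m :=
      Subtype.ext (hsucc m)
    rw [e, ih]

/-! ### §3. `RelNormCoherentUnits.ofGlobal` -/

variable [IsTotallyComplex K]
  (h𝔪 : 𝔪 ≠ ⊥) (hv : ¬ 𝔪 ≤ v.asIdeal) (hw : ∀ u : (𝓞 K)ˣ, (u : 𝓞 K) - 1 ∈ 𝔪 → u = 1)
  {π : 𝒪[v.adicCompletion K]} (hπ : (valuation (v.adicCompletion K)).IsUniformizer (π : v.adicCompletion K))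
  {α : 𝓞 K} (hα0 : α ≠ 0) (hα𝔪 : α - 1 ∈ 𝔪) (hαw : ∀ w : HeightOneSpectrum (𝓞 K), w ≠ v → α ∉ w.asIdeal)
  {f : ℕ} (hαπ : ((α : K) : v.adicCompletion K) = (π : v.adicCompletion K) ^ f)
  (E : IntermediateField (v.adicCompletion K) (AlgebraicClosure (v.adicCompletion K)))
  [FiniteDimensional (v.adicCompletion K) E] [IsGalois (v.adicCompletion K) E] (hE : E ≤ maxUnramified (v.adicCompletion K))
  (hdegE : ∀ w : WeilGroup (v.adicCompletion K),
    WeilGroup.toAbsGalois (v.adicCompletion K) w ∈ E.fixingSubgroup → (f : ℤ) ∣ WeilGroup.deg w)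

/-- ★ **A norm-coherent sequence of GLOBAL units along `K(𝔪v^{m+1})` as an element of `𝒰_𝔓 = RelNormCoherentUnits hπ E`**
(de Shalit's `β(𝔞) = (e_n(𝔞))_n ∈ 𝒰` for the elliptic units `e_n(𝔞) = Θ(1; 𝔣𝔭^{n+1}, 𝔞)`): the data are `x_m ∈ K(𝔪v^{m+1})`,
non-zero algebraic integers with algebraic-integer inverses, with `N_{K(𝔪v^{m+1})/K(𝔪v^{n+1})} x_m = x_n` (`n ≤ m`, Mathlib's
`Algebra.norm` for the inclusion); the components are `ι(x_m) ∈ E·K_π^{m+1}` (`RayClassFieldLocalTowerContainment`), of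
absolute value `1` (§1), norm-coherent along `E·K_π^{m+1}` by THE NORM COMPATIBILITY
(`absClosureEmbedding_towerNorm_rayClassField_mul_pow_eq`). [cite: deShalit1987, II.4.5 (12) (p. 58), II.1.10 (p. 39), III.1.2 (p. 101)] -/
def _root_.Literature.NumberTheory.GaloisRepresentations.RelNormCoherentUnits.ofGlobal
    (x : ∀ m : ℕ, rayClassField K (𝔪 * v.asIdeal ^ (m + 1)))
    (hx0 : ∀ m, ((x m : rayClassField K (𝔪 * v.asIdeal ^ (m + 1))) : AlgebraicClosure K) ≠ 0)
    (hint : ∀ m, IsIntegral ℤ ((x m : rayClassField K (𝔪 * v.asIdeal ^ (m + 1))) : AlgebraicClosure K))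
    (hint' : ∀ m, IsIntegral ℤ ((x m : rayClassField K (𝔪 * v.asIdeal ^ (m + 1))) : AlgebraicClosure K)⁻¹)
    (hcoh : ∀ n m (hnm : n ≤ m),
      ((@Algebra.norm (rayClassField K (𝔪 * v.asIdeal ^ (n + 1))) (rayClassField K (𝔪 * v.asIdeal ^ (m + 1))) _ _
          (towerAlgebra (rayClassField_mul_pow_succ_mono h𝔪 v hnm)) (x m) :
        rayClassField K (𝔪 * v.asIdeal ^ (n + 1))) : AlgebraicClosure K) = x n) :
    RelNormCoherentUnits hπ E where
  val m := ⟨⟨absClosureEmbedding K (v.adicCompletion K) (x m),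
      absClosureEmbedding_mem_sup_ltField_of_mem_rayClassField_mul_pow h𝔪 hv hπ hα0 hα𝔪 hαw hαπ E hdegE m (x m).2⟩,
    (mem_unitBall_iff _).mpr (le_of_eq (by
      haveI : FiniteDimensional (v.adicCompletion K)
          (E ⊔ ltField π m : IntermediateField (v.adicCompletion K) (AlgebraicClosure (v.adicCompletion K))) :=
        IntermediateField.finiteDimensional_sup E (ltField π m)
      exact norm_mk_absClosureEmbedding_eq_one_of_isIntegral _ (hx0 m) (hint m) (hint' m) _))⟩
  norm_eq_one m := by
    haveI : FiniteDimensional (v.adicCompletion K)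
        (E ⊔ ltField π m : IntermediateField (v.adicCompletion K) (AlgebraicClosure (v.adicCompletion K))) :=
      IntermediateField.finiteDimensional_sup E (ltField π m)
    exact norm_mk_absClosureEmbedding_eq_one_of_isIntegral _ (hx0 m) (hint m) (hint' m) _
  coherent n m hnm := by
    apply Subtype.ext
    change ((@Algebra.norm (E ⊔ ltField π n : IntermediateField (v.adicCompletion K) (AlgebraicClosure (v.adicCompletion K)))
        (E ⊔ ltField π m : IntermediateField (v.adicCompletion K) (AlgebraicClosure (v.adicCompletion K))) _ _
        (towerAlgebra (sup_le_sup_left (ltField_mono hπ hnm) E))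
        ⟨absClosureEmbedding K (v.adicCompletion K) (x m),
          absClosureEmbedding_mem_sup_ltField_of_mem_rayClassField_mul_pow h𝔪 hv hπ hα0 hα𝔪 hαw hαπ E hdegE m (x m).2⟩ :
        (E ⊔ ltField π n : IntermediateField (v.adicCompletion K) (AlgebraicClosure (v.adicCompletion K)))) :
        AlgebraicClosure (v.adicCompletion K)) = absClosureEmbedding K (v.adicCompletion K) (x n)
    rw [← absClosureEmbedding_towerNorm_rayClassField_mul_pow_eq h𝔪 hv hw hπ hα0 hα𝔪 hαw hαπ E hE hdegE hnm (x m), hcoh n m hnm]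

/-- Components of `ofGlobal x` (unfolding): `(ofGlobal x)_m = ι(x_m)`. [cite: deShalit1987, II.4.5 (12) (p. 58)] -/
theorem coe_val_ofGlobal (x : ∀ m : ℕ, rayClassField K (𝔪 * v.asIdeal ^ (m + 1)))
    (hx0 : ∀ m, ((x m : rayClassField K (𝔪 * v.asIdeal ^ (m + 1))) : AlgebraicClosure K) ≠ 0)
    (hint : ∀ m, IsIntegral ℤ ((x m : rayClassField K (𝔪 * v.asIdeal ^ (m + 1))) : AlgebraicClosure K))
    (hint' : ∀ m, IsIntegral ℤ ((x m : rayClassField K (𝔪 * v.asIdeal ^ (m + 1))) : AlgebraicClosure K)⁻¹)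
    (hcoh : ∀ n m (hnm : n ≤ m),
      ((@Algebra.norm (rayClassField K (𝔪 * v.asIdeal ^ (n + 1))) (rayClassField K (𝔪 * v.asIdeal ^ (m + 1))) _ _
          (towerAlgebra (rayClassField_mul_pow_succ_mono h𝔪 v hnm)) (x m) :
        rayClassField K (𝔪 * v.asIdeal ^ (n + 1))) : AlgebraicClosure K) = x n) (m : ℕ) :
    ((((RelNormCoherentUnits.ofGlobal h𝔪 hv hw hπ hα0 hα𝔪 hαw hαπ E hE hdegE x hx0 hint hint' hcoh).val m :
        unitBall (E ⊔ ltField π m : IntermediateField (v.adicCompletion K) (AlgebraicClosure (v.adicCompletion K)))) :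
        (E ⊔ ltField π m : IntermediateField (v.adicCompletion K) (AlgebraicClosure (v.adicCompletion K)))) :
      AlgebraicClosure (v.adicCompletion K)) =
      absClosureEmbedding K (v.adicCompletion K) (x m) := rfl

/-- **`ofGlobal` depends only on the sequence `(x_m)` read in `K̄`** (not on the integrality / coherence witnesses).
[cite: deShalit1987, II.4.5 (12) (p. 58)] -/
theorem ofGlobal_congr {x x' : ∀ m : ℕ, rayClassField K (𝔪 * v.asIdeal ^ (m + 1))}
    {hx0 : ∀ m, ((x m : rayClassField K (𝔪 * v.asIdeal ^ (m + 1))) : AlgebraicClosure K) ≠ 0}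
    {hint : ∀ m, IsIntegral ℤ ((x m : rayClassField K (𝔪 * v.asIdeal ^ (m + 1))) : AlgebraicClosure K)}
    {hint' : ∀ m, IsIntegral ℤ ((x m : rayClassField K (𝔪 * v.asIdeal ^ (m + 1))) : AlgebraicClosure K)⁻¹}
    {hcoh : ∀ n m (hnm : n ≤ m),
      ((@Algebra.norm (rayClassField K (𝔪 * v.asIdeal ^ (n + 1))) (rayClassField K (𝔪 * v.asIdeal ^ (m + 1))) _ _
          (towerAlgebra (rayClassField_mul_pow_succ_mono h𝔪 v hnm)) (x m) :
        rayClassField K (𝔪 * v.asIdeal ^ (n + 1))) : AlgebraicClosure K) = x n}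
    {hx0' : ∀ m, ((x' m : rayClassField K (𝔪 * v.asIdeal ^ (m + 1))) : AlgebraicClosure K) ≠ 0}
    {hint₁ : ∀ m, IsIntegral ℤ ((x' m : rayClassField K (𝔪 * v.asIdeal ^ (m + 1))) : AlgebraicClosure K)}
    {hint₁' : ∀ m, IsIntegral ℤ ((x' m : rayClassField K (𝔪 * v.asIdeal ^ (m + 1))) : AlgebraicClosure K)⁻¹}
    {hcoh' : ∀ n m (hnm : n ≤ m),
      ((@Algebra.norm (rayClassField K (𝔪 * v.asIdeal ^ (n + 1))) (rayClassField K (𝔪 * v.asIdeal ^ (m + 1))) _ _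
          (towerAlgebra (rayClassField_mul_pow_succ_mono h𝔪 v hnm)) (x' m) :
        rayClassField K (𝔪 * v.asIdeal ^ (n + 1))) : AlgebraicClosure K) = x' n}
    (h : ∀ m, ((x m : rayClassField K (𝔪 * v.asIdeal ^ (m + 1))) : AlgebraicClosure K) = x' m) :
    RelNormCoherentUnits.ofGlobal h𝔪 hv hw hπ hα0 hα𝔪 hαw hαπ E hE hdegE x hx0 hint hint' hcoh =
      RelNormCoherentUnits.ofGlobal h𝔪 hv hw hπ hα0 hα𝔪 hαw hαπ E hE hdegE x' hx0' hint₁ hint₁' hcoh' :=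
  RelNormCoherentUnits.ext fun m ↦ Subtype.ext (Subtype.ext (by
    change absClosureEmbedding K (v.adicCompletion K) (x m) = absClosureEmbedding K (v.adicCompletion K) (x' m)
    rw [h m]))

/-! ### §4. Multiplicativity -/

attribute [local instance] RelNormCoherentUnits.instCommMonoid

/-- ★ **Multiplicativity**: if `x''_m = x_m · x'_m` in `K̄` for all `m` then `ofGlobal x'' = ofGlobal x · ofGlobal x'` in the monoid
`𝒰_𝔓` (the termwise product). [cite: deShalit1987, II.4.5 (12)–(13) (p. 58), I.2.3 (i) (p. 14)] -/
theorem ofGlobal_mul_eq {x x' x'' : ∀ m : ℕ, rayClassField K (𝔪 * v.asIdeal ^ (m + 1))}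
    {hx0 : ∀ m, ((x m : rayClassField K (𝔪 * v.asIdeal ^ (m + 1))) : AlgebraicClosure K) ≠ 0}
    {hint : ∀ m, IsIntegral ℤ ((x m : rayClassField K (𝔪 * v.asIdeal ^ (m + 1))) : AlgebraicClosure K)}
    {hint' : ∀ m, IsIntegral ℤ ((x m : rayClassField K (𝔪 * v.asIdeal ^ (m + 1))) : AlgebraicClosure K)⁻¹}
    {hcoh : ∀ n m (hnm : n ≤ m),
      ((@Algebra.norm (rayClassField K (𝔪 * v.asIdeal ^ (n + 1))) (rayClassField K (𝔪 * v.asIdeal ^ (m + 1))) _ _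
          (towerAlgebra (rayClassField_mul_pow_succ_mono h𝔪 v hnm)) (x m) :
        rayClassField K (𝔪 * v.asIdeal ^ (n + 1))) : AlgebraicClosure K) = x n}
    {hx0' : ∀ m, ((x' m : rayClassField K (𝔪 * v.asIdeal ^ (m + 1))) : AlgebraicClosure K) ≠ 0}
    {hint₁ : ∀ m, IsIntegral ℤ ((x' m : rayClassField K (𝔪 * v.asIdeal ^ (m + 1))) : AlgebraicClosure K)}
    {hint₁' : ∀ m, IsIntegral ℤ ((x' m : rayClassField K (𝔪 * v.asIdeal ^ (m + 1))) : AlgebraicClosure K)⁻¹}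
    {hcoh' : ∀ n m (hnm : n ≤ m),
      ((@Algebra.norm (rayClassField K (𝔪 * v.asIdeal ^ (n + 1))) (rayClassField K (𝔪 * v.asIdeal ^ (m + 1))) _ _
          (towerAlgebra (rayClassField_mul_pow_succ_mono h𝔪 v hnm)) (x' m) :
        rayClassField K (𝔪 * v.asIdeal ^ (n + 1))) : AlgebraicClosure K) = x' n}
    {hx0'' : ∀ m, ((x'' m : rayClassField K (𝔪 * v.asIdeal ^ (m + 1))) : AlgebraicClosure K) ≠ 0}
    {hint₂ : ∀ m, IsIntegral ℤ ((x'' m : rayClassField K (𝔪 * v.asIdeal ^ (m + 1))) : AlgebraicClosure K)}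
    {hint₂' : ∀ m, IsIntegral ℤ ((x'' m : rayClassField K (𝔪 * v.asIdeal ^ (m + 1))) : AlgebraicClosure K)⁻¹}
    {hcoh'' : ∀ n m (hnm : n ≤ m),
      ((@Algebra.norm (rayClassField K (𝔪 * v.asIdeal ^ (n + 1))) (rayClassField K (𝔪 * v.asIdeal ^ (m + 1))) _ _
          (towerAlgebra (rayClassField_mul_pow_succ_mono h𝔪 v hnm)) (x'' m) :
        rayClassField K (𝔪 * v.asIdeal ^ (n + 1))) : AlgebraicClosure K) = x'' n}
    (h : ∀ m, ((x'' m : rayClassField K (𝔪 * v.asIdeal ^ (m + 1))) : AlgebraicClosure K) = x m * x' m) :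
    RelNormCoherentUnits.ofGlobal h𝔪 hv hw hπ hα0 hα𝔪 hαw hαπ E hE hdegE x'' hx0'' hint₂ hint₂' hcoh'' =
      RelNormCoherentUnits.ofGlobal h𝔪 hv hw hπ hα0 hα𝔪 hαw hαπ E hE hdegE x hx0 hint hint' hcoh *
        RelNormCoherentUnits.ofGlobal h𝔪 hv hw hπ hα0 hα𝔪 hαw hαπ E hE hdegE x' hx0' hint₁ hint₁' hcoh' :=
  RelNormCoherentUnits.ext fun m ↦ Subtype.ext (Subtype.ext (by
    change absClosureEmbedding K (v.adicCompletion K) (x'' m) =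
      absClosureEmbedding K (v.adicCompletion K) (x m) * absClosureEmbedding K (v.adicCompletion K) (x' m)
    rw [h m, map_mul]))

/-- `ofGlobal` of the constant sequence `1` is `1`. [cite: deShalit1987, I.2.3 (i) (p. 14)] -/
theorem ofGlobal_one_eq {x : ∀ m : ℕ, rayClassField K (𝔪 * v.asIdeal ^ (m + 1))}
    {hx0 : ∀ m, ((x m : rayClassField K (𝔪 * v.asIdeal ^ (m + 1))) : AlgebraicClosure K) ≠ 0}
    {hint : ∀ m, IsIntegral ℤ ((x m : rayClassField K (𝔪 * v.asIdeal ^ (m + 1))) : AlgebraicClosure K)}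
    {hint' : ∀ m, IsIntegral ℤ ((x m : rayClassField K (𝔪 * v.asIdeal ^ (m + 1))) : AlgebraicClosure K)⁻¹}
    {hcoh : ∀ n m (hnm : n ≤ m),
      ((@Algebra.norm (rayClassField K (𝔪 * v.asIdeal ^ (n + 1))) (rayClassField K (𝔪 * v.asIdeal ^ (m + 1))) _ _
          (towerAlgebra (rayClassField_mul_pow_succ_mono h𝔪 v hnm)) (x m) :
        rayClassField K (𝔪 * v.asIdeal ^ (n + 1))) : AlgebraicClosure K) = x n}
    (h : ∀ m, ((x m : rayClassField K (𝔪 * v.asIdeal ^ (m + 1))) : AlgebraicClosure K) = 1) :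
    RelNormCoherentUnits.ofGlobal h𝔪 hv hw hπ hα0 hα𝔪 hαw hαπ E hE hdegE x hx0 hint hint' hcoh = 1 :=
  RelNormCoherentUnits.ext fun m ↦ Subtype.ext (Subtype.ext (by
    change absClosureEmbedding K (v.adicCompletion K) (x m) = ((1 : (E ⊔ ltField π m :
      IntermediateField (v.adicCompletion K) (AlgebraicClosure (v.adicCompletion K)))) : AlgebraicClosure (v.adicCompletion K))
    rw [h m, map_one, OneMemClass.coe_one]))

/-! ### §5. Equivariance: the `κ_v`-action on `𝒰_𝔓` is the Galois action on the global units -/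

/-- ★★ **Components of `g • ofGlobal x`**: for `g ∈ Gal(K̄/K(𝔪))`, `(g • ofGlobal x)_m = ι(g|_{K(𝔪v^{m+1})} x_m)` — the inertia lift
`w_g` of the `κ_v`-action acts on `ι(K(𝔪v^{m+1}))` as `g` does on `K(𝔪v^{m+1})` (`κ_v(res w_g) = κ_v(g)` and elements of
`Gal(K̄/K(𝔪))` with the same `κ_v` agree on every `K(𝔪vⁿ)`). [cite: deShalit1987, II.4.5 (13) (p. 58), II.1.10 Corollary (p. 39), II.1.7 (p. 41)] -/
theorem coe_val_rayAction_smul_ofGlobal (x : ∀ m : ℕ, rayClassField K (𝔪 * v.asIdeal ^ (m + 1)))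
    (hx0 : ∀ m, ((x m : rayClassField K (𝔪 * v.asIdeal ^ (m + 1))) : AlgebraicClosure K) ≠ 0)
    (hint : ∀ m, IsIntegral ℤ ((x m : rayClassField K (𝔪 * v.asIdeal ^ (m + 1))) : AlgebraicClosure K))
    (hint' : ∀ m, IsIntegral ℤ ((x m : rayClassField K (𝔪 * v.asIdeal ^ (m + 1))) : AlgebraicClosure K)⁻¹)
    (hcoh : ∀ n m (hnm : n ≤ m),
      ((@Algebra.norm (rayClassField K (𝔪 * v.asIdeal ^ (n + 1))) (rayClassField K (𝔪 * v.asIdeal ^ (m + 1))) _ _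
          (towerAlgebra (rayClassField_mul_pow_succ_mono h𝔪 v hnm)) (x m) :
        rayClassField K (𝔪 * v.asIdeal ^ (n + 1))) : AlgebraicClosure K) = x n)
    (g : ↥(absRestrictNormalHom (rayClassField K 𝔪)).ker) (m : ℕ) :
    letI := rayAction h𝔪 hv hw hπ E hE
    ((((g • RelNormCoherentUnits.ofGlobal h𝔪 hv hw hπ hα0 hα𝔪 hαw hαπ E hE hdegE x hx0 hint hint' hcoh).val m :
        unitBall (E ⊔ ltField π m : IntermediateField (v.adicCompletion K) (AlgebraicClosure (v.adicCompletion K)))) :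
        (E ⊔ ltField π m : IntermediateField (v.adicCompletion K) (AlgebraicClosure (v.adicCompletion K)))) :
      AlgebraicClosure (v.adicCompletion K)) =
      absClosureEmbedding K (v.adicCompletion K)
        ((absRestrictNormalHom (rayClassField K (𝔪 * v.asIdeal ^ (m + 1))) (g : absoluteGaloisGroup K) (x m) :
          rayClassField K (𝔪 * v.asIdeal ^ (m + 1))) : AlgebraicClosure K) := by
  letI := rayAction h𝔪 hv hw hπ E hE
  haveI := normal_sup_ltField hπ E m
  rw [rayAction_smul_def, RelNormCoherentUnits.coe_val_galAct, coe_relRestrict_apply]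
  change WeilGroup.toAbsGalois (v.adicCompletion K) (rayInertiaLift h𝔪 hv hw g) •
      absClosureEmbedding K (v.adicCompletion K) (x m) = _
  rw [← absGaloisRestrict_apply_smul]
  have hres : absRestrictNormalHom (rayClassField K (𝔪 * v.asIdeal ^ (m + 1)))
      (absGaloisRestrict K (v.adicCompletion K) (WeilGroup.toAbsGalois (v.adicCompletion K) (rayInertiaLift h𝔪 hv hw g))) =
      absRestrictNormalHom (rayClassField K (𝔪 * v.asIdeal ^ (m + 1))) (g : absoluteGaloisGroup K) :=
    absRestrictNormalHom_eq_of_rayAdicCharacter_eq h𝔪 hv hw (rayAdicCharacter_rayInertiaLift h𝔪 hv hw g) (m + 1)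
  have h1 : ((absRestrictNormalHom (rayClassField K (𝔪 * v.asIdeal ^ (m + 1)))
      (absGaloisRestrict K (v.adicCompletion K) (WeilGroup.toAbsGalois (v.adicCompletion K) (rayInertiaLift h𝔪 hv hw g)))
        (x m) : rayClassField K (𝔪 * v.asIdeal ^ (m + 1))) : AlgebraicClosure K) =
      absGaloisRestrict K (v.adicCompletion K) (WeilGroup.toAbsGalois (v.adicCompletion K) (rayInertiaLift h𝔪 hv hw g)) •
        ((x m : rayClassField K (𝔪 * v.asIdeal ^ (m + 1))) : AlgebraicClosure K) :=
    AlgEquiv.restrictNormalHom_apply _ _ _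
  rw [← h1, hres]

/-- ★★ **EQUIVARIANCE `g • ofGlobal x = ofGlobal (g · x)`**: for `g ∈ Gal(K̄/K(𝔪))` and any admissible sequence `x'` with
`x'_m = g|_{K(𝔪v^{m+1})} x_m` in `K̄`, the `κ_v`-action of `PAdicOneVariableRelNormCoherentUnitsRayAction` satisfies
`g • ofGlobal x = ofGlobal x'` — de Shalit's "`𝒰` is a `𝒢`-module and `β(𝔞)^σ = β` of the conjugate units" on the
`𝔓`-component. [cite: deShalit1987, II.4.5 (13) (p. 58), II.1.10 Corollary (p. 39)] -/
theorem rayAction_smul_ofGlobal_eq_ofGlobal {x x' : ∀ m : ℕ, rayClassField K (𝔪 * v.asIdeal ^ (m + 1))}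
    {hx0 : ∀ m, ((x m : rayClassField K (𝔪 * v.asIdeal ^ (m + 1))) : AlgebraicClosure K) ≠ 0}
    {hint : ∀ m, IsIntegral ℤ ((x m : rayClassField K (𝔪 * v.asIdeal ^ (m + 1))) : AlgebraicClosure K)}
    {hint' : ∀ m, IsIntegral ℤ ((x m : rayClassField K (𝔪 * v.asIdeal ^ (m + 1))) : AlgebraicClosure K)⁻¹}
    {hcoh : ∀ n m (hnm : n ≤ m),
      ((@Algebra.norm (rayClassField K (𝔪 * v.asIdeal ^ (n + 1))) (rayClassField K (𝔪 * v.asIdeal ^ (m + 1))) _ _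
          (towerAlgebra (rayClassField_mul_pow_succ_mono h𝔪 v hnm)) (x m) :
        rayClassField K (𝔪 * v.asIdeal ^ (n + 1))) : AlgebraicClosure K) = x n}
    {hx0' : ∀ m, ((x' m : rayClassField K (𝔪 * v.asIdeal ^ (m + 1))) : AlgebraicClosure K) ≠ 0}
    {hint₁ : ∀ m, IsIntegral ℤ ((x' m : rayClassField K (𝔪 * v.asIdeal ^ (m + 1))) : AlgebraicClosure K)}
    {hint₁' : ∀ m, IsIntegral ℤ ((x' m : rayClassField K (𝔪 * v.asIdeal ^ (m + 1))) : AlgebraicClosure K)⁻¹}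
    {hcoh' : ∀ n m (hnm : n ≤ m),
      ((@Algebra.norm (rayClassField K (𝔪 * v.asIdeal ^ (n + 1))) (rayClassField K (𝔪 * v.asIdeal ^ (m + 1))) _ _
          (towerAlgebra (rayClassField_mul_pow_succ_mono h𝔪 v hnm)) (x' m) :
        rayClassField K (𝔪 * v.asIdeal ^ (n + 1))) : AlgebraicClosure K) = x' n}
    (g : ↥(absRestrictNormalHom (rayClassField K 𝔪)).ker)
    (h : ∀ m, ((x' m : rayClassField K (𝔪 * v.asIdeal ^ (m + 1))) : AlgebraicClosure K) =
      ((absRestrictNormalHom (rayClassField K (𝔪 * v.asIdeal ^ (m + 1))) (g : absoluteGaloisGroup K) (x m) :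
          rayClassField K (𝔪 * v.asIdeal ^ (m + 1))) : AlgebraicClosure K)) :
    letI := rayAction h𝔪 hv hw hπ E hE
    g • RelNormCoherentUnits.ofGlobal h𝔪 hv hw hπ hα0 hα𝔪 hαw hαπ E hE hdegE x hx0 hint hint' hcoh =
      RelNormCoherentUnits.ofGlobal h𝔪 hv hw hπ hα0 hα𝔪 hαw hαπ E hE hdegE x' hx0' hint₁ hint₁' hcoh' := by
  letI := rayAction h𝔪 hv hw hπ E hE
  refine RelNormCoherentUnits.ext fun m ↦ Subtype.ext (Subtype.ext ?_)
  rw [coe_val_rayAction_smul_ofGlobal, coe_val_ofGlobal, h m]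

end OfGlobal

end Literature.NumberTheory.EllipticCurves

end
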